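import Mathlib
import Summits.PneNP.PneNP.Theorems.OverlapGapAlgebraNoStableSectionDefs
import Summits.PneNP.PneNP.Theorems.OverlapGapAlgebraNoStableSectionEntropy
import Summits.PneNP.PneNP.Theorems.OverlapGapAlgebraNoStableSectionLadder

/-!
# Route OverlapGapAlgebra, crux `SearchHardWindow` (stmt-PneNP-2460), line `Sketch`: the moat
# (ladder extraction along a chain of outputs)

Stub `stub_moat` of the skeleton `Summits/PneNP/PneNP/Cruxes/SearchHardWindow/Lines/Sketch.lean`
(section `HS25`): the deterministic moat / ladder extraction of Huang–Sellke 2025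
(arXiv:2501.06427, Lemma 3.25 with the continuity Lemma 3.24), which is Bresler–Huang's
Proposition 4.6 / Lemma 4.8 (arXiv:2106.02129) run along a chain of outputs `x 0, x 1, …`.

The potential of a candidate `v : Fin n → Bool` given the rungs `R 0, …, R (ℓ-1)` is the
Bresler–Huang (unordered) conditional overlap entropy, i.e. the DartGame ordered conditional type
entropy `condEnt` of the rung-`0`-NORMALISED sequence:
`h R ℓ v = condEnt (fun j i => withRung R ℓ v j i ⊕ R 0 i) ℓ`.
Since normalisation commutes with `withRung` (`moat_norm_withRung`), the DartGame entropy toolkit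
(`condEnt_withRung_eq_zero_of_mem`, `abs_condEnt_withRung_sub_le_binEntropy`) transfers to `h`:
it vanishes on a repeated rung (`moat_pot_rep`), is local in the prefix for `ℓ ≥ 1`
(`moat_pot_loc`), and is `h₂(Δ/n)`-continuous in the candidate (`moat_pot_lip`, using that xor by a
fixed vector preserves Hamming distances, `moat_hammingDist_xor`).  The abstract ladder extraction
of `OverlapGapAlgebraNoStableSectionLadder` is then re-run (`moat_ladder_step`,
`moat_ladderExtraction`) with the chaos-freeness hypothesis restricted to increasing rung times
starting at `0` (the only ones the recursion ever produces) and the Lipschitz hypothesis restricted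
to times `< T`, `k W ≤ T`: by the discrete intermediate value theorem `ladder_ivt`, the next rung
time is the first time after `ts ℓ` at which the potential reaches `β - η`; it is at most
`ts ℓ + W` because one window later the potential already exceeds `β`.
-/

set_option linter.dupNamespace false -- `Summit.PneNP.PneNP.…`: summit = sub-problem

namespace Summit.PneNP.PneNP.Theorems

open Finset
open Summit.PneNP.PneNP.Cruxes.NoStableSection.DartGame (condEnt withRung withRung_of_lt
  withRung_of_le withRung_self condEnt_congr condEnt_withRung_congr condEnt_withRung_eq_zero_of_mem
  abs_condEnt_withRung_sub_le_binEntropy ladder_ivt ladder_le_mul ladder_mono)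

/-! ## The abstract ladder with chaos-freeness for increasing rung times only -/

/-- The inductive step of the ladder extraction (cf. `ladder_step`), with the lower bound `hind`
only assumed for rung times `ts` with `ts 0 = 0` that increase strictly below `ℓ`, and the one-step
bound `hlip` only below the horizon `T ≥ k W`: given rung times `ts 0 = 0 < ⋯ < ts ℓ` with gaps
`≤ W` and `ℓ + 1 ≤ k`, some `s ∈ (ts ℓ, ts ℓ + W]` has potential in `[bm, bp]` given the first
`ℓ + 1` rungs. -/
theorem moat_ladder_step {V : Type} {k W T : ℕ} {x : ℕ → V} {h : (ℕ → V) → ℕ → V → ℝ}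
    {δ bm bp : ℝ} (hW : 0 < W) (hbm : 0 ≤ bm) (hδ : δ ≤ bp - bm) (hT : k * W ≤ T)
    (hrep : ∀ (R : ℕ → V) (ℓ : ℕ) (v : V), (∃ j < ℓ, R j = v) → h R ℓ v = 0)
    (hlip : ∀ (R : ℕ → V) (ℓ t : ℕ), t < T → |h R ℓ (x (t + 1)) - h R ℓ (x t)| ≤ δ)
    (hind : ∀ (ℓ : ℕ) (ts : ℕ → ℕ) (t : ℕ), 1 ≤ ℓ → ℓ ≤ k → ts 0 = 0 →
      (∀ j, j + 1 < ℓ → ts j < ts (j + 1)) → (∀ j < ℓ, ts j + W ≤ t) → t ≤ T →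
      bp < h (fun j => x (ts j)) ℓ (x t))
    {ℓ : ℕ} {ts : ℕ → ℕ} (hℓk : ℓ + 1 ≤ k) (h0 : ts 0 = 0)
    (hgap : ∀ i < ℓ, ts i < ts (i + 1) ∧ ts (i + 1) ≤ ts i + W) :
    ∃ s, ts ℓ < s ∧ s ≤ ts ℓ + W ∧ h (fun j => x (ts j)) (ℓ + 1) (x s) ∈ Set.Icc bm bp := by
  -- adapted from `ladder_step` of `OverlapGapAlgebraNoStableSectionLadder`
  have hts_le : ts ℓ ≤ ℓ * W := ladder_le_mul h0 hgap ℓ le_rfl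
  have ht' : ts ℓ + W ≤ T := by
    calc ts ℓ + W ≤ ℓ * W + W := by omega
      _ = (ℓ + 1) * W := by ring
      _ ≤ k * W := Nat.mul_le_mul_right _ hℓk
      _ ≤ T := hT
  -- the potential of the candidate `x s` given the first `ℓ + 1` rungs
  set f : ℕ → ℝ := fun s => h (fun j => x (ts j)) (ℓ + 1) (x s) with hf
  -- it vanishes at the last rung time
  have hf0 : f (ts ℓ) = 0 := hrep _ _ _ ⟨ℓ, Nat.lt_succ_self ℓ, rfl⟩
  -- and exceeds `bp` one window later
  have hft' : bp < f (ts ℓ + W) := by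
    refine hind (ℓ + 1) ts (ts ℓ + W) (by omega) hℓk h0 (fun j hj => (hgap j (by omega)).1) ?_ ht'
    intro j hj
    have := ladder_mono hgap ℓ le_rfl j (by omega)
    omega
  -- one-step increments are at most `δ` up to time `ts ℓ + W ≤ T`
  have hlip' : ∀ t ≤ ts ℓ + (W - 1), f (t + 1) ≤ f t + δ := by
    intro t ht
    have habs : |f (t + 1) - f t| ≤ δ := hlip (fun j => x (ts j)) (ℓ + 1) t (by omega)
    have := (abs_le.mp habs).2
    linarith
  have hδ0 : 0 ≤ δ := by
    have habs : |f (ts ℓ + 1) - f (ts ℓ)| ≤ δ :=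
      hlip (fun j => x (ts j)) (ℓ + 1) (ts ℓ) (by omega)
    exact (abs_nonneg _).trans habs
  have hb : bm ≤ f (ts ℓ + 1 + (W - 1)) := by
    have h1 : ts ℓ + 1 + (W - 1) = ts ℓ + W := by omega
    rw [h1]
    linarith
  obtain ⟨s, hs1, hs2, hs3, hs4⟩ := ladder_ivt (hf0.le.trans hbm) hb hlip'
  exact ⟨s, hs1, by omega, hs3, show f s ≤ bp by linarith⟩

/-- Ladder extraction (cf. `stub_ladderExtraction`, abstract form of Bresler–Huang Prop. 4.6) with
the lower bound `hind` only for increasing rung times starting at `0`, the one-step bound only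
below the horizon `T ≥ k W`, and locality only for `ℓ ≥ 1`: there are rung times
`ts 0 = 0 < ts 1 < ⋯ < ts k` with consecutive gaps `≤ W` such that every rung `ℓ ≥ 1` has
potential in `[bm, bp]` given its predecessors. -/
theorem moat_ladderExtraction {V : Type} {k W T : ℕ} {x : ℕ → V} {h : (ℕ → V) → ℕ → V → ℝ}
    {δ bm bp : ℝ} (hW : 0 < W) (hbm : 0 ≤ bm) (hδ : δ ≤ bp - bm) (hT : k * W ≤ T)
    (hloc : ∀ (R R' : ℕ → V) (ℓ : ℕ) (v : V), 1 ≤ ℓ → (∀ j < ℓ, R j = R' j) →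
      h R ℓ v = h R' ℓ v)
    (hrep : ∀ (R : ℕ → V) (ℓ : ℕ) (v : V), (∃ j < ℓ, R j = v) → h R ℓ v = 0)
    (hlip : ∀ (R : ℕ → V) (ℓ t : ℕ), t < T → |h R ℓ (x (t + 1)) - h R ℓ (x t)| ≤ δ)
    (hind : ∀ (ℓ : ℕ) (ts : ℕ → ℕ) (t : ℕ), 1 ≤ ℓ → ℓ ≤ k → ts 0 = 0 →
      (∀ j, j + 1 < ℓ → ts j < ts (j + 1)) → (∀ j < ℓ, ts j + W ≤ t) → t ≤ T →
      bp < h (fun j => x (ts j)) ℓ (x t)) :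
    ∃ ts : ℕ → ℕ, ts 0 = 0 ∧ (∀ ℓ < k, ts ℓ < ts (ℓ + 1) ∧ ts (ℓ + 1) ≤ ts ℓ + W) ∧
      ∀ ℓ, 1 ≤ ℓ → ℓ ≤ k → h (fun j => x (ts j)) ℓ (x (ts ℓ)) ∈ Set.Icc bm bp := by
  -- adapted from `stub_ladderExtraction` of `OverlapGapAlgebraNoStableSectionLadder`
  suffices H : ∀ ℓ ≤ k, ∃ ts : ℕ → ℕ, ts 0 = 0 ∧
      (∀ i < ℓ, ts i < ts (i + 1) ∧ ts (i + 1) ≤ ts i + W) ∧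
      ∀ i, 1 ≤ i → i ≤ ℓ → h (fun j => x (ts j)) i (x (ts i)) ∈ Set.Icc bm bp from
    H k le_rfl
  intro ℓ
  induction ℓ with
  | zero =>
    intro _
    exact ⟨fun _ => 0, rfl, fun i hi => absurd hi (Nat.not_lt_zero _),
      fun i h1 h2 => absurd (h1.trans h2) (by norm_num)⟩
  | succ ℓ ih =>
    intro hℓk
    obtain ⟨ts, h0, hgap, hval⟩ := ih (by omega)
    obtain ⟨s₀, hs₀lt, hs₀le, hs₀val⟩ :=
      moat_ladder_step hW hbm hδ hT hrep hlip hind hℓk h0 hgap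
    refine ⟨Function.update ts (ℓ + 1) s₀, ?_, ?_, ?_⟩
    · rw [Function.update_of_ne (by omega : (0 : ℕ) ≠ ℓ + 1)]
      exact h0
    · intro i hi
      rcases Nat.lt_or_ge i ℓ with hil | hil
      · rw [Function.update_of_ne (by omega : i ≠ ℓ + 1),
          Function.update_of_ne (by omega : i + 1 ≠ ℓ + 1)]
        exact hgap i hil
      · obtain rfl : i = ℓ := by omega
        rw [Function.update_self, Function.update_of_ne (by omega : i ≠ i + 1)]
        exact ⟨hs₀lt, hs₀le⟩
    · intro i h1i hi
      have key : h (fun j => x (Function.update ts (ℓ + 1) s₀ j)) i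
          = h (fun j => x (ts j)) i := by
        funext v
        refine hloc _ _ i v h1i ?_
        intro j hj
        rw [Function.update_of_ne (by omega : j ≠ ℓ + 1)]
      rw [key]
      rcases Nat.lt_or_ge i (ℓ + 1) with hil | hil
      · rw [Function.update_of_ne (by omega : i ≠ ℓ + 1)]
        exact hval i h1i (by omega)
      · rw [le_antisymm hi hil, Function.update_self]
        exact hs₀val

/-! ## The normalised potential -/

/-- Xor by a fixed vector preserves Hamming distances. -/
theorem moat_hammingDist_xor {n : ℕ} (v v' c : Fin n → Bool) :
    hammingDist (fun i => Bool.xor (v i) (c i)) (fun i => Bool.xor (v' i) (c i)) =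
      hammingDist v v' :=
  hammingDist_comp (fun i b => Bool.xor b (c i)) fun _ _ _ hab => Bool.xor_left_inj.1 hab

/-- Normalisation by rung `0` commutes with the insertion of a candidate: the normalised sequence of
`withRung R ℓ v` is `withRung` of the normalised prefix and the normalised candidate. -/
theorem moat_norm_withRung {n : ℕ} (R : ℕ → Fin n → Bool) (ℓ : ℕ) (v : Fin n → Bool) :
    (fun j i => Bool.xor (withRung R ℓ v j i) (R 0 i)) =
      withRung (fun j i => Bool.xor (R j i) (R 0 i)) ℓ (fun i => Bool.xor (v i) (R 0 i)) := by
  funext j i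
  by_cases hj : j < ℓ
  · rw [withRung_of_lt R ℓ v hj, withRung_of_lt _ ℓ _ hj]
  · rw [withRung_of_le R ℓ v (Nat.not_lt.1 hj), withRung_of_le _ ℓ _ (Nat.not_lt.1 hj)]

/-- The normalised potential vanishes on a candidate repeating an earlier rung
(Bresler–Huang Fact 4.5(iii), via `condEnt_withRung_eq_zero_of_mem`). -/
theorem moat_pot_rep {n : ℕ} (R : ℕ → Fin n → Bool) (ℓ : ℕ) (v : Fin n → Bool)
    (hv : ∃ j < ℓ, R j = v) :
    condEnt (fun j i => Bool.xor (withRung R ℓ v j i) (R 0 i)) ℓ = 0 := by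
  rw [moat_norm_withRung]
  obtain ⟨j₀, hj₀, rfl⟩ := hv
  exact condEnt_withRung_eq_zero_of_mem n ℓ _ _ ⟨j₀, hj₀, rfl⟩

/-- The normalised potential given the first `ℓ ≥ 1` rungs only reads those rungs. -/
theorem moat_pot_loc {n : ℕ} {R R' : ℕ → Fin n → Bool} {ℓ : ℕ} (hℓ : 1 ≤ ℓ)
    (hRR' : ∀ j < ℓ, R j = R' j) (v : Fin n → Bool) :
    condEnt (fun j i => Bool.xor (withRung R ℓ v j i) (R 0 i)) ℓ =
      condEnt (fun j i => Bool.xor (withRung R' ℓ v j i) (R' 0 i)) ℓ := by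
  rw [moat_norm_withRung, moat_norm_withRung, hRR' 0 (by omega)]
  refine condEnt_withRung_congr (fun j hj => ?_) _
  funext i
  rw [hRR' j hj]

/-- The normalised potential is `h₂(Δ/n)`-continuous in the candidate for Hamming distance
`Δ ≤ n/2` (Bresler–Huang Lemma 4.8 / Huang–Sellke Lemma 3.24, via
`abs_condEnt_withRung_sub_le_binEntropy` and `moat_hammingDist_xor`). -/
theorem moat_pot_lip {n : ℕ} (R : ℕ → Fin n → Bool) (ℓ : ℕ) (v v' : Fin n → Bool)
    (hd : (hammingDist v v' : ℝ) ≤ n / 2) :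
    |condEnt (fun j i => Bool.xor (withRung R ℓ v j i) (R 0 i)) ℓ -
        condEnt (fun j i => Bool.xor (withRung R ℓ v' j i) (R 0 i)) ℓ| ≤
      Real.binEntropy ((hammingDist v v' : ℝ) / n) := by
  have key := abs_condEnt_withRung_sub_le_binEntropy n ℓ (fun j i => Bool.xor (R j i) (R 0 i))
    (fun i => Bool.xor (v i) (R 0 i)) (fun i => Bool.xor (v' i) (R 0 i))
  rw [moat_hammingDist_xor] at key
  rw [moat_norm_withRung, moat_norm_withRung]
  exact key hd

/-- On the rung itself the normalised potential is the conditional type entropy of the normalised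
sequence (the form of the conclusion of `stub_moat`). -/
theorem moat_pot_self {n : ℕ} (R : ℕ → Fin n → Bool) (ℓ : ℕ) :
    condEnt (fun j i => Bool.xor (withRung R ℓ (R ℓ) j i) (R 0 i)) ℓ =
      condEnt (fun j i => Bool.xor (R j i) (R 0 i)) ℓ := by
  refine condEnt_congr fun j hj => ?_
  funext i
  rcases hj.lt_or_eq with h | rfl
  · rw [withRung_of_lt R ℓ _ h]
  · rw [withRung_self]

/-! ## The moat -/

/-- **The moat / ladder extraction along a chain** (Huang–Sellke 2025 Lemma 3.25 with the
continuity Lemma 3.24 = Bresler–Huang Prop. 4.6 / Lemma 4.8), over the DartGame toolkit of crux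
`NoStableSection`; the Bresler–Huang conditional overlap entropy of a candidate `v` given rungs
`R 0 … R (ℓ-1)` is `condEnt` of the rung-`0`-normalised sequence. Along outputs `x 0, x 1, …`
whose consecutive Hamming distances `Δ ≤ n/2` have `h₂(Δ/n) ≤ η` before the horizon `T`, if every
candidate at a time at least `W` after all earlier rung times has conditional overlap entropy
`> β` (chaos-freeness, for increasing rung times starting at `0`), and `k W ≤ T`, then there are
rung times `0 = ts 0 < ts 1 < ⋯ < ts k`, consecutive gaps `≤ W`, whose outputs have every
conditional overlap entropy in `[β − η, β]` (the forbidden OGP structure). -/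
theorem stub_moat (n k W T : ℕ) (x : ℕ → (Fin n → Bool)) (β η : ℝ)
    (hW : 0 < W) (hη : 0 < η) (hηβ : η < β) (hT : k * W ≤ T)
    (hstab : ∀ t < T, (hammingDist (x t) (x (t + 1)) : ℝ) ≤ n / 2 ∧
      Real.binEntropy ((hammingDist (x t) (x (t + 1)) : ℝ) / n) ≤ η)
    (hchaos : ∀ (ℓ : ℕ) (ts : ℕ → ℕ) (t : ℕ), 1 ≤ ℓ → ℓ ≤ k → ts 0 = 0 →
      (∀ j, j + 1 < ℓ → ts j < ts (j + 1)) → (∀ j < ℓ, ts j + W ≤ t) → t ≤ T →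
      β < condEnt (fun j i => Bool.xor (withRung (fun j => x (ts j)) ℓ (x t) j i) (x (ts 0) i)) ℓ) :
    ∃ ts : ℕ → ℕ, ts 0 = 0 ∧ (∀ ℓ < k, ts ℓ < ts (ℓ + 1) ∧ ts (ℓ + 1) ≤ ts ℓ + W) ∧
      ∀ ℓ, 1 ≤ ℓ → ℓ ≤ k →
        condEnt (fun j i => Bool.xor (x (ts j) i) (x (ts 0) i)) ℓ ∈ Set.Icc (β - η) β := by
  -- the band `[β - η, β]` is nonempty and lies in `[0, ∞)`
  have hbm : 0 ≤ β - η := by linarith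
  have hδ : η ≤ β - (β - η) := by linarith
  obtain ⟨ts, h0, hgap, hval⟩ := moat_ladderExtraction (V := Fin n → Bool) (x := x)
    (h := fun R ℓ v => condEnt (fun j i => Bool.xor (withRung R ℓ v j i) (R 0 i)) ℓ)
    hW hbm hδ hT
    (fun R R' ℓ v hℓ hRR' => moat_pot_loc hℓ hRR' v)
    (fun R ℓ v hv => moat_pot_rep R ℓ v hv)
    (fun R ℓ t ht => by
      obtain ⟨h1, h2⟩ := hstab t ht
      rw [hammingDist_comm] at h1 h2
      exact (moat_pot_lip R ℓ (x (t + 1)) (x t) h1).trans h2)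
    (fun ℓ ts t h1 h2 h3 h4 h5 h6 => hchaos ℓ ts t h1 h2 h3 h4 h5 h6)
  refine ⟨ts, h0, hgap, fun ℓ h1 h2 => ?_⟩
  have key := hval ℓ h1 h2
  -- `hη` is implied by the one-step bounds whenever `T > 0`; it is not needed otherwise
  have _hη := hη
  simpa only [moat_pot_self] using key

end Summit.PneNP.PneNP.Theorems
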